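import Literature.AlgebraicGeometry.Modules.CechEndCochainFamily
import HarnessLib

/-!
# Framed Čech cochains of `𝓔nd(E)` under a change of frames

Let `𝔣 = (U_a, I_a, e_a)` be a framing of an `𝒪_X`-module `E` (`Modules/CechEndCochain.lean`) and
`e'_a : 𝒪^{I'_a} ≅ E|_{U_a}` other frames over the SAME opens. With the change-of-frame matrices
`u_a = T(e_a, e'_a)`, `u'_a = T(e'_a, e_a)` (mutually inverse):

* `Framing.reframe 𝔣 e'` — the framing by the `e'_a` (reducible: same opens, new index types);
* `T_reframe` — `T'_{ab} = u'_a T_{ab} u_b`;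
* `op_reframe` — **the local endomorphism with matrix `A'` in the new frames is the local
  endomorphism with matrix `u_a A' u'_z` in the old ones** (`matrixEnd_changeFrame`);
* `Cochain.conj` — the conjugate cochain `α ↦ u_{α₀} X'_α u'_{αₙ}` of a matrix cochain `X'` of the
  new framing, and **`toLocalFamily' X' = toLocalFamily (conj X')`** (`toLocalFamily_reframe`): the
  family of local endomorphisms of a matrix cochain does not see the frames.

This is the frame-independence half of the well-definedness of Čech classes of `𝓔nd(E)`-valued
cochains given by matrices (Hartshorne, *Deformation Theory*, proof of Thm. 7.1: "one checks that
the class does not depend on the choice of the local trivialisations"). Everything is proved; no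
named facts.

## References

* R. Hartshorne, *Algebraic Geometry*, GTM 52 (1977), II.5 (p. 109, change of basis). [Hartshorne1977]
* R. Hartshorne, *Deformation Theory*, GTM 257 (2010), §7, proof of Thm. 7.1. [Hartshorne2010]
-/

noncomputable section

open CategoryTheory AlgebraicGeometry Opposite TopologicalSpace Limits

namespace Literature.AlgebraicGeometry.Modules

open Literature.AlgebraicGeometry.Motives

universe u

variable {X : Scheme.{u}} {E : X.Modules} {ι : Type u}

namespace Framing

variable (𝔣 : Framing E ι) {I' : ι → Type u} (e' : ∀ a, SheafOfModules.free (I' a) ≅ E.over (𝔣.U a))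

/-! ### Change-of-frame matrices -/

/-- The change-of-frame matrix `u_a = T(e_a, e'_a)` over `V ≤ U_a`. [folklore] -/
def u (a : ι) (V : X.Opens) (ha : V ≤ 𝔣.U a) : Matrix (𝔣.I a) (I' a) Γ(X, V) :=
  transition (𝔣.e a) (e' a) (homOfLE ha) (homOfLE ha)

/-- The inverse change-of-frame matrix `u'_a = T(e'_a, e_a)` over `V ≤ U_a`. [folklore] -/
def u' (a : ι) (V : X.Opens) (ha : V ≤ 𝔣.U a) : Matrix (I' a) (𝔣.I a) Γ(X, V) :=
  transition (e' a) (𝔣.e a) (homOfLE ha) (homOfLE ha)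

/-- `u_a` is compatible with restriction. [folklore] -/
lemma u_map (a : ι) {V V' : X.Opens} (ha : V ≤ 𝔣.U a) (h : V' ≤ V) :
    (𝔣.u e' a V ha).map (secRes X h) = 𝔣.u e' a V' (h.trans ha) :=
  transition_map (𝔣.e a) (e' a) (homOfLE ha) (homOfLE ha) (homOfLE h)

/-- `u'_a` is compatible with restriction. [folklore] -/
lemma u'_map (a : ι) {V V' : X.Opens} (ha : V ≤ 𝔣.U a) (h : V' ≤ V) :
    (𝔣.u' e' a V ha).map (secRes X h) = 𝔣.u' e' a V' (h.trans ha) :=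
  transition_map (e' a) (𝔣.e a) (homOfLE ha) (homOfLE ha) (homOfLE h)

variable [∀ a, Fintype (I' a)]

/-- `u_a u'_a = 1`. [folklore] -/
lemma u_mul_u' (a : ι) (V : X.Opens) (ha : V ≤ 𝔣.U a) : 𝔣.u e' a V ha * 𝔣.u' e' a V ha = 1 :=
  transition_mul_symm _ _ _ _

variable [∀ a, DecidableEq (I' a)]

/-- `u'_a u_a = 1`. [folklore] -/
lemma u'_mul_u (a : ι) (V : X.Opens) (ha : V ≤ 𝔣.U a) : 𝔣.u' e' a V ha * 𝔣.u e' a V ha = 1 :=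
  transition_mul_symm _ _ _ _

/-! ### Reframing a framing -/

/-- **The framing with the same opens and the new frames `e'_a`** (reducible, so that its opens are
those of `𝔣` and its index types are `I'` syntactically). [folklore] -/
abbrev reframe : Framing E ι where
  U := 𝔣.U
  I := I'
  e := e'

/-- **Transition matrices after reframing**: `T'_{ab} = u'_a T_{ab} u_b`.
[cite: Hartshorne1977, II.5 (p. 109)] -/
theorem T_reframe (a b : ι) (V : X.Opens) (ha : V ≤ 𝔣.U a) (hb : V ≤ 𝔣.U b) :
    (𝔣.reframe e').T a b V ha hb = 𝔣.u' e' a V ha * 𝔣.T a b V ha hb * 𝔣.u e' b V hb := by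
  rw [T, u', T, u, transition_mul, transition_mul]

/-- **Local endomorphisms after reframing**: the endomorphism with matrix `A'` in the frames
`e'_a, e'_z` is the endomorphism with matrix `u_a A' u'_z` in the frames `e_a, e_z`.
[cite: Hartshorne1977, II.5 (p. 109)] -/
theorem op_reframe (a z : ι) (V : X.Opens) (ha : V ≤ 𝔣.U a) (hz : V ≤ 𝔣.U z)
    (A' : Matrix (I' a) (I' z) Γ(X, V)) :
    (𝔣.reframe e').op a z V ha hz A' = 𝔣.op a z V ha hz (𝔣.u e' a V ha * A' * 𝔣.u' e' z V hz) := by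
  rw [op, op, T_reframe, matrixEnd_changeFrame (𝔣.e a) (e' a) (homOfLE ha) (homOfLE ha)]
  change matrixEnd (𝔣.e a) (homOfLE ha)
    (𝔣.u e' a V ha * (A' * (𝔣.u' e' z V hz * 𝔣.T z a V hz ha * 𝔣.u e' a V ha)) * 𝔣.u' e' a V ha) = _
  congr 1
  simp only [Matrix.mul_assoc]
  rw [u_mul_u', Matrix.mul_one]

/-! ### Conjugating cochains back to the old frames -/

namespace Cochain

variable {𝔣 e'} {n : ℕ}

/-- **The conjugate cochain `α ↦ u_{α₀} X'_α u'_{αₙ}`** of a matrix cochain of the reframed framing.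
[folklore] -/
def conj (c' : (𝔣.reframe e').Cochain n) : 𝔣.Cochain n where
  mat α V hV := 𝔣.u e' (α 0) V (hV 0) * c'.mat α V hV * 𝔣.u' e' (α (Fin.last n)) V (hV (Fin.last n))
  map_mat α V V' hV h := by
    rw [Matrix.map_mul, Matrix.map_mul, u_map, u'_map, c'.map_mat]

/-- Matrices of the conjugate cochain. [folklore] -/
@[simp] lemma conj_mat (c' : (𝔣.reframe e').Cochain n) (α : Fin (n + 1) → ι) (V : X.Opens)
    (hV : ∀ k, V ≤ 𝔣.U (α k)) :
    (conj c').mat α V hV =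
      𝔣.u e' (α 0) V (hV 0) * c'.mat α V hV * 𝔣.u' e' (α (Fin.last n)) V (hV (Fin.last n)) :=
  rfl

end Cochain

/-- **The family of local endomorphisms of a matrix cochain does not see the frames**:
`toLocalFamily' X' = toLocalFamily (u X' u')`. [cite: Hartshorne2010, §7 (proof of Thm. 7.1)] -/
theorem toLocalFamily_reframe {n : ℕ} (c' : (𝔣.reframe e').Cochain n) :
    (𝔣.reframe e').toLocalFamily c' = 𝔣.toLocalFamily (Cochain.conj c') := by
  funext α
  rw [toLocalFamily_apply, toLocalFamily_apply, op_reframe]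
  rfl

end Framing

end Literature.AlgebraicGeometry.Modules

end
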